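import Mathlib
import HarnessLib

/-!
# The orthogonal sum `L₁ ⊕ L₂ ⊂ K ⊕ Kᗮ = V` of two lattices is a lattice

Topic `Algebra/EuclideanLattices`; namespace `Literature.Algebra.EuclideanLattices.OrthogonalSum`. For a real
inner product space `V`, a subspace `K ≤ V`, and `ℤ`-submodules `L₁ ≤ K`, `L₂ ≤ Kᗮ`:

* `lat V K L₁ L₂ : Submodule ℤ V` — the split lattice `L₁ ⊕ L₂` (the images of `L₁`, `L₂` in `V`, summed),
  `mem_lat : v ∈ lat ↔ ∃ l₁ ∈ L₁, ∃ l₂ ∈ L₂, l₁ + l₂ = v`;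
* `norm_le_norm_add_of_mem`, `norm_le_norm_add_of_mem'` — Pythagoras: each orthogonal summand is bounded by
  the sum, `‖p‖, ‖q‖ ≤ ‖p + q‖` for `p ∈ K`, `q ∈ Kᗮ`;
* `exists_norm_lt_imp_eq_zero` — a discrete `ℤ`-submodule is uniformly isolated at `0`;
* `discreteTopology_lat` — `L₁`, `L₂` discrete ⇒ `L₁ ⊕ L₂` discrete (isolation constants + Pythagoras);
* `isZLattice_lat` — `V` finite-dimensional and `L₁`, `L₂` full lattices of `K`, `Kᗮ` ⇒ `L₁ ⊕ L₂` is a full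
  `ℤ`-lattice of `V` (`K ⊕ Kᗮ = V`).

This is the "direct (orthogonal) sum of lattices" of the lattice literature (Conway–Sloane, *SPLAG*, Ch. 4
§3 "gluing theory": an integral lattice with a sublattice that is a direct sum; Witt's decomposition into
orthogonal sums of indecomposables, O'Meara §105) in Mathlib's `IsZLattice` language, where the two
bookkeeping facts (discreteness, full rank) need proofs.

Provenance: HodgeCM PerL cell `pub-hodgecm`, seat pv15-g6 — §2 of the RUN-31 staging file
`KernelModelHeisenbergPair.lean` (the split lattice of a Heisenberg dual pair `K ⊕ Kᗮ`), extracted VERBATIM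
(names `HodgeCM.SchwartzWeil.HeisenbergPair.X` ↦ `Literature.Algebra.EuclideanLattices.OrthogonalSum.X`) for
the tree under the LEAN-IN-TREE rule, with the isolation lemma `exists_norm_lt_imp_eq_zero` (PKG
`HodgeCM/Automorphic/WeilThetaModelSchrodinger.lean`) inlined.

## References

* J. H. Conway, N. J. A. Sloane, *Sphere Packings, Lattices and Groups*, 3rd ed. (1993/1999), Ch. 4 §3
  (gluing; direct sums of lattices) [ConwaySloane1999].
* O. T. O'Meara, *Introduction to Quadratic Forms* (1963), §105 (orthogonal splittings of lattices).
-/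

noncomputable section

open scoped RealInnerProductSpace

namespace Literature.Algebra.EuclideanLattices

namespace OrthogonalSum

section Isolation

variable (E : Type*) [NormedAddCommGroup E] (L : AddSubgroup E) [DiscreteTopology L]

/-- A discrete subgroup of a normed group is uniformly isolated at `0`: `‖v‖ < ε ⇒ v = 0` for some `ε > 0`.
[folklore] -/
theorem exists_norm_lt_imp_eq_zero : ∃ ε : ℝ, 0 < ε ∧ ∀ v : L, ‖(v : E)‖ < ε → v = 0 := by
  have hopen : IsOpen ({0} : Set L) := isOpen_discrete _
  obtain ⟨ε, hε, hball⟩ := Metric.isOpen_iff.1 hopen 0 (Set.mem_singleton 0)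
  refine ⟨ε, hε, fun v hv => ?_⟩
  have hv' : v ∈ Metric.ball (0 : L) ε := by
    rw [Metric.mem_ball, dist_zero_right]
    simpa only [AddSubgroup.coe_norm] using hv
  exact hball hv'

end Isolation

section Lattice

variable (V : Type*) [NormedAddCommGroup V] [InnerProductSpace ℝ V] (K : Submodule ℝ V) (L₁ : Submodule ℤ K)
  (L₂ : Submodule ℤ Kᗮ)

/-- **The split lattice** `L := L₁ ⊕ L₂ ⊂ V`: the sum of the images of `L₁ ≤ K` and `L₂ ≤ Kᗮ` in `V`.
[folklore] -/
def lat : Submodule ℤ V := L₁.map (K.subtype.restrictScalars ℤ) ⊔ L₂.map (Kᗮ.subtype.restrictScalars ℤ)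

/-- Membership in the split lattice: `v = l₁ + l₂` with `lᵢ ∈ Lᵢ`. [folklore] -/
theorem mem_lat {v : V} : v ∈ lat V K L₁ L₂ ↔ ∃ l₁ ∈ L₁, ∃ l₂ ∈ L₂, (l₁ : V) + (l₂ : V) = v := by
  rw [lat, Submodule.mem_sup]
  constructor
  · rintro ⟨y, hy, z, hz, rfl⟩
    obtain ⟨l₁, hl₁, rfl⟩ := Submodule.mem_map.mp hy
    obtain ⟨l₂, hl₂, rfl⟩ := Submodule.mem_map.mp hz
    exact ⟨l₁, hl₁, l₂, hl₂, rfl⟩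
  · rintro ⟨l₁, hl₁, l₂, hl₂, rfl⟩
    exact ⟨(l₁ : V), Submodule.mem_map.mpr ⟨l₁, hl₁, rfl⟩, (l₂ : V), Submodule.mem_map.mpr ⟨l₂, hl₂, rfl⟩, rfl⟩

/-- `L₁ ⊂ L₁ ⊕ L₂`. [folklore] -/
theorem coe_mem_lat₁ {l₁ : K} (hl₁ : l₁ ∈ L₁) : (l₁ : V) ∈ lat V K L₁ L₂ :=
  (mem_lat V K L₁ L₂).mpr ⟨l₁, hl₁, 0, L₂.zero_mem, by rw [Submodule.coe_zero, add_zero]⟩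

/-- `L₂ ⊂ L₁ ⊕ L₂`. [folklore] -/
theorem coe_mem_lat₂ {l₂ : Kᗮ} (hl₂ : l₂ ∈ L₂) : (l₂ : V) ∈ lat V K L₁ L₂ :=
  (mem_lat V K L₁ L₂).mpr ⟨0, L₁.zero_mem, l₂, hl₂, by rw [Submodule.coe_zero, zero_add]⟩

/-- Orthogonality controls each summand (Pythagoras): `‖q‖ ≤ ‖p + q‖` for `p ∈ K`, `q ∈ Kᗮ`. [folklore] -/
theorem norm_le_norm_add_of_mem {p q : V} (hp : p ∈ K) (hq : q ∈ Kᗮ) : ‖q‖ ≤ ‖p + q‖ := by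
  have h := norm_add_sq_eq_norm_sq_add_norm_sq_real (Submodule.inner_right_of_mem_orthogonal hp hq)
  nlinarith [norm_nonneg p, norm_nonneg q, norm_nonneg (p + q)]

/-- … and `‖p‖ ≤ ‖p + q‖`. [folklore] -/
theorem norm_le_norm_add_of_mem' {p q : V} (hp : p ∈ K) (hq : q ∈ Kᗮ) : ‖p‖ ≤ ‖p + q‖ := by
  have h := norm_add_sq_eq_norm_sq_add_norm_sq_real (Submodule.inner_right_of_mem_orthogonal hp hq)
  nlinarith [norm_nonneg p, norm_nonneg q, norm_nonneg (p + q)]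

variable [DiscreteTopology L₁] [DiscreteTopology L₂]

/-- **`L₁ ⊕ L₂` is discrete** when `L₁` and `L₂` are (isolation constants of `L₁`, `L₂` and Pythagoras).
[folklore] -/
instance discreteTopology_lat : DiscreteTopology (lat V K L₁ L₂) := by
  obtain ⟨ε₁, hε₁, h₁⟩ := exists_norm_lt_imp_eq_zero K L₁.toAddSubgroup
  obtain ⟨ε₂, hε₂, h₂⟩ := exists_norm_lt_imp_eq_zero Kᗮ L₂.toAddSubgroup
  refine discreteTopology_of_isOpen_singleton_zero ?_
  have hopen : IsOpen ((Subtype.val : lat V K L₁ L₂ → V) ⁻¹' Metric.ball 0 (min ε₁ ε₂)) :=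
    Metric.isOpen_ball.preimage continuous_subtype_val
  convert hopen using 1
  ext v
  simp only [Set.mem_singleton_iff, Set.mem_preimage, Metric.mem_ball, dist_zero_right]
  constructor
  · rintro rfl
    rw [ZeroMemClass.coe_zero, norm_zero]
    exact lt_min hε₁ hε₂
  · intro hv
    obtain ⟨l₁, hl₁, l₂, hl₂, hv12⟩ := (mem_lat V K L₁ L₂).mp v.2
    have hn₁ : ‖(l₁ : V)‖ < ε₁ :=
      lt_of_le_of_lt (by rw [← hv12]; exact norm_le_norm_add_of_mem' V K l₁.2 l₂.2)
        (lt_of_lt_of_le hv (min_le_left _ _))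
    have hn₂ : ‖(l₂ : V)‖ < ε₂ :=
      lt_of_le_of_lt (by rw [← hv12]; exact norm_le_norm_add_of_mem V K l₁.2 l₂.2)
        (lt_of_lt_of_le hv (min_le_right _ _))
    have e₁ : (⟨l₁, hl₁⟩ : L₁.toAddSubgroup) = 0 := h₁ ⟨l₁, hl₁⟩ (by simpa using hn₁)
    have e₂ : (⟨l₂, hl₂⟩ : L₂.toAddSubgroup) = 0 := h₂ ⟨l₂, hl₂⟩ (by simpa using hn₂)
    have e₁' : (l₁ : V) = 0 := by
      have := congrArg (fun x : L₁.toAddSubgroup => ((x : K) : V)) e₁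
      simpa using this
    have e₂' : (l₂ : V) = 0 := by
      have := congrArg (fun x : L₂.toAddSubgroup => ((x : Kᗮ) : V)) e₂
      simpa using this
    apply Subtype.ext
    rw [ZeroMemClass.coe_zero, ← hv12, e₁', e₂', add_zero]

variable [FiniteDimensional ℝ V] [IsZLattice ℝ L₁] [IsZLattice ℝ L₂]

/-- **`L₁ ⊕ L₂` is a full `ℤ`-lattice of `V`** when `L₁`, `L₂` are full lattices of `K`, `Kᗮ`
(`K ⊕ Kᗮ = V`). [folklore] -/
instance isZLattice_lat : IsZLattice ℝ (lat V K L₁ L₂) where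
  span_top := by
    refine Submodule.eq_top_iff'.mpr fun v => ?_
    obtain ⟨y, hy, z, hz, rfl⟩ := K.exists_add_mem_mem_orthogonal v
    refine Submodule.add_mem _ ?_ ?_
    · have h1 : (⟨y, hy⟩ : K) ∈ Submodule.span ℝ (L₁ : Set K) := by
        rw [IsZLattice.span_top]; trivial
      have h2 : Submodule.span ℝ (L₁ : Set K) ≤
          (Submodule.span ℝ (lat V K L₁ L₂ : Set V)).comap K.subtype := by
        rw [Submodule.span_le]
        intro l hl
        exact Submodule.subset_span (coe_mem_lat₁ V K L₁ L₂ hl)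
      exact h2 h1
    · have h1 : (⟨z, hz⟩ : Kᗮ) ∈ Submodule.span ℝ (L₂ : Set Kᗮ) := by
        rw [IsZLattice.span_top]; trivial
      have h2 : Submodule.span ℝ (L₂ : Set Kᗮ) ≤
          (Submodule.span ℝ (lat V K L₁ L₂ : Set V)).comap Kᗮ.subtype := by
        rw [Submodule.span_le]
        intro l hl
        exact Submodule.subset_span (coe_mem_lat₂ V K L₁ L₂ hl)
      exact h2 h1

end Lattice

end OrthogonalSum

end Literature.Algebra.EuclideanLattices

end
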